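import Literature.AnabelianGeometry.EtaleTheta.Discharge.Sec4Thm44

/-!
# [EtTh] Theorem 4.4 (ii): "`Ψ` preserves fraction-pairs" — reduction to its [FrdI] inputs

S. Mochizuki, *The étale theta function …*, Publ. RIMS **45** (2009) [MochizukiEtTh2009], Thm 4.4 (ii),
PDF p.94: "`Ψ` induces a 1-compatible equivalence of categories `Ψ^birat : C₁^birat ≅ C₂^birat`.
Moreover, `Ψ` preserves fraction-pairs …".  Proof, p.95: "`Ψ` preserves pre-steps, morphisms of Frobenius
type, Frobenius degrees, isometries, and base-Frobenius pairs [cf. [FrdI] Thm 3.4 (ii), (iii); Cor 4.10];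
… `Ψ` induces a 1-compatible equivalence `Ψ^birat` [cf. [FrdI] Cor 4.10]."

Proof-only companion (owner abc-iut-L2-t3, gen 2) of `BiKummerRoots.lean` (`Thm44_ii`; v2: two base fields `K`, `K'`).  A fraction-pair
(Def 4.1 (i)) is: two PRE-STEPS, BASE-EQUIVALENT, with prescribed FRACTION `s'·(s'')⁻¹ = f` in
`O^×(A^birat)`, with DISJOINT SUPPORTS of `Div(s')`, `Div(s'')`.  Of these four clauses exactly one is
transported by the bare `Thm44Hyp` (an equivalence `Ψ` with `Base ∘ Ψ ≅ Ψ^bs ∘ Base`): base-equivalence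
(`Thm44Hyp.baseEquivalent_map`, PROVED).  The other three are the category-theoreticity inputs the printed
proof cites, and enter as hypotheses: `Ψ` preserves pre-steps ([FrdI] Thm 3.4 (iii)), `Ψ^birat` (the datum
`ψ`) is compatible with the fractions `s'·(s'')⁻¹` ([FrdI] Cor 4.10), and `Ψ` preserves disjointness of
supports of zero divisors ([FrdI] Thm 4.9).  Result: `thm44_ii_of` — Thm 4.4 (ii) as typed, MODULO those
three named inputs.  HONEST FRAMING: refereed pre-IUT material; nothing here bears on [IUTchIII] Cor. 3.12.
-/

namespace Literature.AnabelianGeometry.EtaleTheta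

open CategoryTheory Opposite Literature.AlgebraicGeometry.Frobenioids

namespace BiKummerSetting

universe u₀ v₀ u v w

variable {K : Type u₀} [Field K] {K' : Type u₀} [Field K'] {D₀ : Type u₀} [Category.{v₀} D₀]
  {V : FrdIMonoidStub.{w}}
  {X₁ : SemiGraphs.TemperedArithmeticGroup.{u₀} K} {X₂ : SemiGraphs.TemperedArithmeticGroup.{u₀} K'}
  {D₀' : Type u₀} [Category.{v₀} D₀']
  {T₁ : RealifiedDivisorMonoids (D₀ := D₀) V} {T₂ : RealifiedDivisorMonoids (D₀ := D₀') V}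
  {D₁ D₂ : Type u} [Category.{v} D₁] [Category.{v} D₂] {VD₁ : FrdICatStub.{u, v, w} D₁}
  {VD₂ : FrdICatStub.{u, v, w} D₂} {S₁ : BiKummerSetting X₁ T₁ D₁ VD₁} {S₂ : BiKummerSetting X₂ T₂ D₂ VD₂}

/-- `Ψ` carries base-equivalent pairs to base-equivalent pairs (through `Base ∘ Ψ ≅ Ψ^bs ∘ Base`) — the one
clause of "fraction-pair" that the bare hypothesis of Thm 4.4 transports. [cite: MochizukiEtTh2009, Thm 4.4 p.94] -/
theorem Thm44Hyp.baseEquivalent_map (h : Thm44Hyp S₁ S₂) {A B : S₁.C} {s' s'' : A ⟶ B}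
    (hb : PreFrobenioid.BaseEquivalent S₁.F s' s'') :
    PreFrobenioid.BaseEquivalent S₂.F (h.Ψ.functor.map s') (h.Ψ.functor.map s'') := by
  have hb' : S₁.base.map s' = S₁.base.map s'' := hb
  show S₂.base.map (h.Ψ.functor.map s') = S₂.base.map (h.Ψ.functor.map s'')
  rw [h.base_map_Ψ, h.base_map_Ψ, hb']

/-- **[EtTh] Theorem 4.4 (ii) ("`Ψ` preserves fraction-pairs") MODULO its [FrdI] inputs**: given that
`Ψ` preserves pre-steps ([FrdI] Thm 3.4 (iii)), that `Ψ^birat = ψ` is compatible with the fractions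
`s'·(s'')⁻¹` ([FrdI] Cor 4.10), and that `Ψ` preserves disjointness of the supports of zero divisors
([FrdI] Thm 4.9), the image of a fraction-pair is a fraction-pair (base-equivalence being transported by
`Thm44Hyp.baseEquivalent_map`). [cite: MochizukiEtTh2009, Thm 4.4 p.94] -/
theorem thm44_ii_of (h : Thm44Hyp S₁ S₂)
    (ψ : ∀ A : S₁.C, S₁.biratUnits A ≃* S₂.biratUnits (h.Ψ.functor.obj A))
    (hPre : ∀ {A B : S₁.C} (s : A ⟶ B), S₁.IsPreStep s → S₂.IsPreStep (h.Ψ.functor.map s))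
    (hfrac : ∀ {A B : S₁.C} (s' s'' : A ⟶ B) (h' : S₁.IsPreStep s') (h'' : S₁.IsPreStep s'')
      (hb : PreFrobenioid.BaseEquivalent S₁.F s' s''),
      S₂.fracOf (h.Ψ.functor.map s') (h.Ψ.functor.map s'') (hPre s' h') (hPre s'' h'')
          (h.baseEquivalent_map hb) = ψ A (S₁.fracOf s' s'' h' h'' hb))
    (hDS : ∀ {A B : S₁.C} (s' s'' : A ⟶ B), S₁.DisjointSupports (S₁.div s') (S₁.div s'') →
      S₂.DisjointSupports (S₂.div (h.Ψ.functor.map s')) (S₂.div (h.Ψ.functor.map s''))) :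
    Thm44_ii h ψ := by
  intro A B f P
  refine ⟨{ num := h.Ψ.functor.map P.num
            den := h.Ψ.functor.map P.den
            isPreStep_num := hPre _ P.isPreStep_num
            isPreStep_den := hPre _ P.isPreStep_den
            base_eq := h.baseEquivalent_map P.base_eq
            frac_eq := ?_
            disjointSupports := hDS _ _ P.disjointSupports }, rfl, rfl⟩
  rw [hfrac P.num P.den P.isPreStep_num P.isPreStep_den P.base_eq, P.frac_eq]

end BiKummerSetting

end Literature.AnabelianGeometry.EtaleTheta
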